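import Summits.CriticalPhenomena.Ising3DConformalLimit.Theses.IsingEuclidUpgrade
import Summits.CriticalPhenomena.Ising3DConformalLimit.Theses.HyperoctahedralRP
import Summits.CriticalPhenomena.Ising3DConformalLimit.Theses.PositivityBegetsConformality
import Summits.CriticalPhenomena.Ising3DConformalLimit.Theses.LeeYangGap
import Summits.CriticalPhenomena.Ising3DConformalLimit.Theorems.LeeYangGapGaussianLimitKillsBlockCoupling
import Summits.CriticalPhenomena.Ising3DConformalLimit.Theorems.PerfectScreeningCoulombImpliesNontrivialOfLeeYangGap
import Literature.Probability.LatticeModels.PointwiseScalingLimitScaleCovariant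

/-!
# Payer edges into crux stmt-CriticalPhenomena-0636 (`IsingEuclidUpgradeR4NonGaussian`) — strategist s1

SORRY-FREE, evidence-grade file (Summits/Theorems is prover-only; any prover may land it verbatim as
`Theorems/IsingEuclidUpgradeR4NonGaussianOfNearCriticalLeeYangGap.lean --supports stmt-CriticalPhenomena-0636`
after `ledger workitem stub-add stmt-CriticalPhenomena-0636 --name stub_cruxOfNearCriticalLeeYangGap …`,
which this seat has done).

**Edge 1 (unconditional).** The live crux `LeeYangGap.NearCriticalLeeYangGap` (item stmt-CriticalPhenomena-4945,
route LeeYangGap rank 2, lead active on `stub_gapReachesEdge` since 2026-08-17T05:15Z) ALONE implies the crux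
0636 for EVERY non-degenerate pointwise scaling limit — no Coulomb antecedent, no Möbius covariance:

* normalise the limit off `NonCoincident` (scale covariance is automatic,
  `HasPointwiseScalingLimit.exists_rpow_scale_mem_Icc`, tree p70600/p71137) — `exists_normalised`;
* a Gaussian (`¬ HasNontrivialU4`) normalised limit kills the block Binder coupling `g_L → 0`
  (`gaussianLimitKillsBlockCoupling_proof`, LeeYangGap item 4950, LANDED);
* a near-critical Lee–Yang zero at the fluctuation scale along a sequence forbids `g_L → 0`
  (`sketchPub_binderNonvanishing_of_nearCriticalLeeYangGap`, LANDED in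
  `PerfectScreeningCoulombImpliesNontrivialOfLeeYangGap.lean`: Camia–Jiang–Newman antitonicity 4947 +
  monotonicity transfer 4948 + Newman's first-zero bound `12/θ⁴ ≤ -u₄`).

So closing 4945 closes 0636 (and with it clause (iii) on the 32 routes wanting 0636). The three decls
`IsingEuclidUpgrade.…`, `HyperoctahedralRP.…`, `PositivityBegetsConformality.…` of the shared item are
definitionally equal; all three edges are recorded.
-/

noncomputable section

namespace Summit.CriticalPhenomena.Ising3DConformalLimit.Cruxes.IsingEuclidUpgradeR4NonGaussian.StrategistPayers

open Literature.Probability.LatticeModels Filter Set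
open scoped Topology

/-- Normalisation glue (same statement and proof as in the live skeleton
`Lines/isotherm_saturation_lee_yang.lean`): every non-degenerate pointwise limit has a normalisation `S'`
(zero off `NonCoincident`) that is again a non-degenerate pointwise limit with the same `ρ`, is scale
covariant with the automatic dimension, and whose `U₄`-non-triviality implies that of `S`. -/
theorem exists_normalised {ρ : ℝ → ℝ} {S : CorrFamily 3}
    (hρ : ∀ δ ∈ Set.Ioc (0:ℝ) 1, 0 < ρ δ) (hlim : HasPointwiseScalingLimit (criticalCorr 3) ρ S)
    (hnd : IsNondegenerateTwoPoint S) :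
    ∃ (Δ : ℝ) (S' : CorrFamily 3), HasPointwiseScalingLimit (criticalCorr 3) ρ S' ∧
      IsNondegenerateTwoPoint S' ∧ IsScaleCovariant Δ S' ∧ (HasNontrivialU4 S' → HasNontrivialU4 S) := by
  classical
  set S' : CorrFamily 3 := fun n z => if Function.Injective z then S n z else 0 with hS'
  have S'_inj : ∀ {n : ℕ} {z : Fin n → EuclideanSpace ℝ (Fin 3)}, Function.Injective z →
      S' n z = S n z := fun hz => by simp only [hS', if_pos hz]
  have S'_ninj : ∀ {n : ℕ} {z : Fin n → EuclideanSpace ℝ (Fin 3)}, ¬ Function.Injective z →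
      S' n z = 0 := fun hz => by simp only [hS', if_neg hz]
  have hlim' : HasPointwiseScalingLimit (criticalCorr 3) ρ S' :=
    fun n => (hlim n).congr_right fun z hz => (S'_inj hz).symm
  have hnd' : IsNondegenerateTwoPoint S' := fun z hz => by rw [S'_inj hz]; exact hnd z hz
  obtain ⟨Δ, -, hcov⟩ := hlim'.exists_rpow_scale_mem_Icc hρ hnd'
  have hsc' : IsScaleCovariant Δ S' := by
    intro n c hc z
    by_cases hz : Function.Injective z
    · exact hcov n c hc z hz
    · have hz' : ¬ Function.Injective (fun i => c • z i) := fun h =>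
        hz ((smul_right_injective (EuclideanSpace ℝ (Fin 3)) hc.ne').of_comp_iff z |>.1 h)
      rw [S'_ninj hz', S'_ninj hz, mul_zero]
  refine ⟨Δ, S', hlim', hnd', hsc', ?_⟩
  rintro ⟨x, hx, hne⟩
  refine ⟨x, hx, ?_⟩
  have hinj : Function.Injective x := hx
  have hpair : ∀ i j : Fin 4, i ≠ j → S' 2 ![x i, x j] = S 2 ![x i, x j] := by
    intro i j hij
    exact S'_inj (pair_mem_nonCoincident (d := 3) fun h => hij (hinj h))
  have h4 : S' 4 x = S 4 x := S'_inj hinj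
  simp only [limitConnectedFour] at hne ⊢
  rwa [h4, hpair 0 1 (by decide), hpair 2 3 (by decide), hpair 0 2 (by decide), hpair 1 3 (by decide),
    hpair 0 3 (by decide), hpair 1 2 (by decide)] at hne

/-- **PAYER EDGE 1.** The near-critical Lee–Yang gap (item stmt-CriticalPhenomena-4945, by name) implies the
crux `IsingEuclidUpgradeR4NonGaussian` (item stmt-CriticalPhenomena-0636; IsingEuclidUpgrade decl), unconditionally. -/
theorem IsingEuclidUpgradeR4NonGaussian_of_nearCriticalLeeYangGap :
    Summit.CriticalPhenomena.Ising3DConformalLimit.Theses.LeeYangGap.NearCriticalLeeYangGap →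
    Summit.CriticalPhenomena.Ising3DConformalLimit.Theses.IsingEuclidUpgrade.IsingEuclidUpgradeR4NonGaussian := by
  intro hGAP ρ S hρ hlim hnd
  obtain ⟨Δ, S', hlim', hnd', hsc', hback⟩ := exists_normalised hρ hlim hnd
  refine hback ?_
  by_contra hU4
  exact Summit.CriticalPhenomena.Ising3DConformalLimit.PerfectScreeningCoulombImpliesNontrivial.sketchPub_binderNonvanishing_of_nearCriticalLeeYangGap
    hGAP
    (Summit.CriticalPhenomena.Ising3DConformalLimit.LeeYangGapGaussianLimitKillsBlockCoupling.gaussianLimitKillsBlockCoupling_proof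
      ρ Δ S' hρ hlim' hnd' hsc' hU4)

/-- The same edge into the HyperoctahedralRP copy of the shared decl (primary route of the crux chain). -/
theorem IsingEuclidUpgradeR4NonGaussian_of_nearCriticalLeeYangGap_hyperoctahedralRP :
    Summit.CriticalPhenomena.Ising3DConformalLimit.Theses.LeeYangGap.NearCriticalLeeYangGap →
    Summit.CriticalPhenomena.Ising3DConformalLimit.Theses.HyperoctahedralRP.IsingEuclidUpgradeR4NonGaussian :=
  IsingEuclidUpgradeR4NonGaussian_of_nearCriticalLeeYangGap

/-- The same edge into the PositivityBegetsConformality copy (the staffed BET route of this strategist unit). -/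
theorem IsingEuclidUpgradeR4NonGaussian_of_nearCriticalLeeYangGap_positivityBegetsConformality :
    Summit.CriticalPhenomena.Ising3DConformalLimit.Theses.LeeYangGap.NearCriticalLeeYangGap →
    Summit.CriticalPhenomena.Ising3DConformalLimit.Theses.PositivityBegetsConformality.IsingEuclidUpgradeR4NonGaussian :=
  IsingEuclidUpgradeR4NonGaussian_of_nearCriticalLeeYangGap

/-- **Registered-stub form** (`stub_cruxOfNearCriticalLeeYangGap`, added with `ledger workitem stub-add` on
stmt-CriticalPhenomena-0636 by this seat): the exact statement a prover lands `--supports stmt-CriticalPhenomena-0636`. -/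
theorem stub_cruxOfNearCriticalLeeYangGap :
    Summit.CriticalPhenomena.Ising3DConformalLimit.Theses.LeeYangGap.NearCriticalLeeYangGap →
    Summit.CriticalPhenomena.Ising3DConformalLimit.Theses.IsingEuclidUpgrade.IsingEuclidUpgradeR4NonGaussian :=
  IsingEuclidUpgradeR4NonGaussian_of_nearCriticalLeeYangGap

end Summit.CriticalPhenomena.Ising3DConformalLimit.Cruxes.IsingEuclidUpgradeR4NonGaussian.StrategistPayers

end
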